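import Summits.SmoothPoincare4.SmoothPoincare4.Theorems.ConvexBisectionAcyclicBisectionExistsHurwitzMoveCrossStrip
import Summits.SmoothPoincare4.SmoothPoincare4.Theorems.ConvexBisectionAcyclicBisectionExistsHurwitzMoveCrossBox
import Summits.SmoothPoincare4.SmoothPoincare4.Theorems.ConvexBisectionAcyclicBisectionExistsBeltMonodromyPages
import Summits.SmoothPoincare4.SmoothPoincare4.Theorems.ConvexBisectionAcyclicBisectionExistsPicardLefschetzChart
import HarnessLib

/-!
# N1-move, bridge (e×) `piece_e_cross`, tool 7: the return map of H4's belt chart is a bijection of the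
# annulus, and the REFLECTED chart for the downward crossing (wave 8, worker J4, brick of stub `stub_M2geo`
# = node N1 ▸ contract `node_N1_move_of_pieces` ▸ `HD` = `piece_e_cross piece_d`, line `modp-braid-orbits`,
# crux `ConvexBisection.AcyclicBisectionExists`, item stmt-SmoothPoincare4-10508; registered sub-goal
# `helper_reflectedChart_periodic`)

Two supplements to H4's two-sided belt chart `(η, G, Λ)` (piece (d), `H4Interface.N1MonoStatement`, for
a rotation family `φ_σ = R_{σ/κ} ∘ φ₀` of annulus charts):

* §1 **`exists_returnMap_inverse`** — `G` is injective on the strip (from the injectivity of `Λ` and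
  ABOVE) and surjective onto it (from COVER: the seam point over an inner point of the level-`σ` annulus,
  which exists by `exists_carrier_of_jA`, lies in the chart), so `helper_exists_inverse_stripMap` gives a
  continuous inverse lift `G'` (displacement `−n₀`);
* §2 **`exists_reflectedChart`** — the chart `Λ' (u, r, σ) = Λ (G' (u, r), −σ)` satisfies the clauses
  of the slab retraction (`CrossSlab.exists_slabRetraction`) with the sign `ε = −1` and the return map
  `G'`: reflecting the levels exchanges BELOW and ABOVE, and re-coordinatising by `G'` makes the new
  lower side plain and the new upper side twisted by `G'` — the DOWNWARD crossing of the bridge (e×).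

Everything is proved; no definitions, no named facts, no `sorry`.  Reference: R. E. Gompf,
A. I. Stipsicz, *4-Manifolds and Kirby Calculus* (1999), §8.2 [GompfStipsicz1999]. [folklore]
-/

noncomputable section

set_option linter.dupNamespace false

open scoped Manifold ContDiff Topology Real
open Set Function Filter

namespace Summit.SmoothPoincare4.SmoothPoincare4.Theorems.AcyclicBisectionExists.ModpBraidOrbits

open Literature.Topology.FourManifolds Literature.Topology.FourManifolds.LefschetzBase
open Literature.Topology.FourManifolds.HandleAttachingMap
open CrossStrip CrossBox

namespace CrossCharts

variable {g n : ℕ} {h : Fin n → HandleAttachingMap 3 2 (Base g)}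
  {X₀ : Type} [TopologicalSpace X₀] [ChartedSpace (EuclideanHalfSpace 4) X₀]
  {X : Type} [TopologicalSpace X] [ChartedSpace (EuclideanHalfSpace 4) X]

/-! ## §1 The return map is a bijection of the strip; its inverse lift -/

/-- **The inverse of the return map.**  For H4's belt chart of the handle `k` (direction `e = d k`,
family `φ`, `|σ| ≤ η₁` inside the tube of `k`, pages `e e^{iσ}`): `G` is injective on the strip
(injectivity of `Λ` + ABOVE) and surjective onto it (COVER at a level `σ₀ ∈ [η/2, η)`: the seam point
over an inner point of the annulus lies in the chart), hence has a continuous inverse lift `G'` with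
displacement `−n₀` (`helper_exists_inverse_stripMap`). [cite: GompfStipsicz1999, §8.2] -/
theorem exists_returnMap_inverse
    (bX : BoundaryData (𝓡∂ 4) X₀ (𝓡 3)) (Ψ : bX.carrier → (bBase g).carrier)
    (G₀ : X₀ ≃ₘ⟮𝓡∂ 4, 𝓡∂ 4⟯ X) (D : MultiAttachmentData h (𝓡∂ 4) X) {d : Fin n → ℂ} {k : Fin n}
    (hd : ∀ j, ‖d j‖ = 1) (hcirc : ∀ θ, (h k).attachingCircle θ ∈ page g (d k))
    (hseam : ∀ (y : bX.carrier) (a : ↥(coresComplement h)), G₀ (bX.incl y) = D.jA a →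
      ∃ c : ℝ, 0 < c ∧ w g ((bBase g).incl (Ψ y)).1 = (c : ℂ) * w g (a : Base g).1)
    {η₁ η : ℝ} (hη : 0 < η) (hηη₁ : η ≤ η₁) (hη1 : η < 2 * Real.pi) (φ : ℝ × ℝ × ℝ → Base g)
    (hφ1 : ∀ u r σ, φ (u + 1, r, σ) = φ (u, r, σ))
    (hφp : ∀ u r σ, σ ∈ Icc (-η₁) η₁ → φ (u, r, σ) ∈ page g (d k * Complex.exp ((σ : ℂ) * Complex.I)))
    (hφt : ∀ u r σ, r ∈ Ioo (-1 : ℝ) 1 → σ ∈ Icc (-η₁) η₁ → φ (u, r, σ) ∈ range (h k).toFun)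
    (hφi : ∀ σ ∈ Icc (-η₁) η₁, InjOn (fun p : ℝ × ℝ => φ (p.1, p.2, σ)) (Ico (0 : ℝ) 1 ×ˢ Ioo (-1 : ℝ) 1))
    {G : ℝ × ℝ → ℝ × ℝ} {n₀ : ℝ} (hGc : Continuous G) (hG1 : ∀ u r, G (u + 1, r) = G (u, r) + (1, 0))
    (hGlo : ∀ u r, r ≤ -(1 / 2 : ℝ) → G (u, r) = (u, r))
    (hGhi : ∀ u r, (1 / 2 : ℝ) ≤ r → G (u, r) = (u + n₀, r))
    (hGstrip : ∀ u r, r ∈ Ioo (-1 : ℝ) 1 → (G (u, r)).2 ∈ Ioo (-1 : ℝ) 1)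
    {Λ : ℝ × ℝ × ℝ → bX.carrier} (hΛi : InjOn Λ (Ico (0 : ℝ) 1 ×ˢ (Ioo (-1 : ℝ) 1 ×ˢ Ioo (-η) η)))
    (hΛ1 : ∀ u r σ, Λ (u + 1, r, σ) = Λ (u, r, σ))
    (habove : ∀ u r σ, r ∈ Ioo (-1 : ℝ) 1 → η / 2 ≤ σ → σ < η →
      ∃ a : ↥(coresComplement h), (a : Base g) = φ ((G (u, r)).1, (G (u, r)).2, σ) ∧
        G₀ (bX.incl (Λ (u, r, σ))) = D.jA a)
    (hcover : ∀ (y : bX.carrier) (σ : ℝ), σ ∈ Ioo (-η) η →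
      (∃ c : ℝ, 0 < c ∧ w g ((bBase g).incl (Ψ y)).1 =
        (c : ℂ) * (d k * Complex.exp ((σ : ℂ) * Complex.I))) →
      (∃ u r, r ∈ Ioo (-1 : ℝ) 1 ∧ Λ (u, r, σ) = y) ∨
      (∃ a : ↥(coresComplement h), G₀ (bX.incl y) = D.jA a ∧
        (a : Base g) ∉ (fun p : ℝ × ℝ => φ (p.1, p.2, σ)) '' (univ ×ˢ Icc (-(1 / 2) : ℝ) (1 / 2)))) :
    ∃ G' : ℝ × ℝ → ℝ × ℝ, Continuous G' ∧ (∀ p, G' (G p) = p) ∧ (∀ q, G (G' q) = q) ∧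
      (∀ u r, G' (u + 1, r) = G' (u, r) + (1, 0)) ∧
      (∀ u r, r ≤ -(1 / 2 : ℝ) → G' (u, r) = (u, r)) ∧
      (∀ u r, (1 / 2 : ℝ) ≤ r → G' (u, r) = (u + -n₀, r)) ∧
      (∀ u r, r ∈ Ioo (-1 : ℝ) 1 → (G' (u, r)).2 ∈ Ioo (-1 : ℝ) 1) := by
  -- the level `σ₀ = η/2` where ABOVE reads the chart through `G`
  set σ₀ : ℝ := η / 2 with hσ₀
  have hσ₀I : σ₀ ∈ Icc (-η₁) η₁ := ⟨by rw [hσ₀]; linarith, by rw [hσ₀]; linarith⟩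
  have hσ₀lt : σ₀ < η := by rw [hσ₀]; linarith
  have hφσi := hφi σ₀ hσ₀I
  have hGint : ∀ (m : ℤ) (u r : ℝ), G (u + m, r) = G (u, r) + ((m : ℝ), 0) := stripMap_int hG1
  -- injectivity on the strip
  have hinj : ∀ p p' : ℝ × ℝ, p.2 ∈ Ioo (-1 : ℝ) 1 → p'.2 ∈ Ioo (-1 : ℝ) 1 → G p = G p' → p = p' := by
    intro p p' hp hp' hG
    obtain ⟨a, ha, hya⟩ := habove p.1 p.2 σ₀ hp le_rfl hσ₀lt
    obtain ⟨a', ha', hya'⟩ := habove p'.1 p'.2 σ₀ hp' le_rfl hσ₀lt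
    have haa' : a = a' := Subtype.ext (by rw [ha, ha', Prod.mk.eta, Prod.mk.eta, hG])
    have hΛeq : Λ (p.1, p.2, σ₀) = Λ (p'.1, p'.2, σ₀) :=
      carrier_unique_of_jA bX G₀ D hya (by rw [haa']; exact hya')
    obtain ⟨h2, m, hm⟩ := box_eq_iff hΛ1 hΛi (p := (p.1, p.2, σ₀)) (p' := (p'.1, p'.2, σ₀))
      ⟨hp, by rw [hσ₀]; constructor <;> linarith⟩ ⟨hp', by rw [hσ₀]; constructor <;> linarith⟩ hΛeq
    simp only [Prod.mk.injEq] at h2 hm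
    have hp'eq : p' = (p.1 + m, p.2) := Prod.ext hm h2.1.symm
    have hm0 : (m : ℝ) = 0 := by
      have e1 : G p' = G p + ((m : ℝ), 0) := by rw [hp'eq, hGint, Prod.mk.eta]
      rw [hG] at e1
      have h1 := congrArg Prod.fst e1
      rw [Prod.fst_add] at h1
      linarith
    rw [hp'eq, hm0, add_zero]
  -- surjectivity onto the strip
  have hsurj : ∀ q : ℝ × ℝ, q.2 ∈ Ioo (-1 : ℝ) 1 → ∃ p : ℝ × ℝ, p.2 ∈ Ioo (-1 : ℝ) 1 ∧ G p = q := by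
    intro q hq
    by_cases hbig : (1 / 2 : ℝ) ≤ |q.2|
    · rcases le_or_gt 0 q.2 with h0 | h0
      · rw [abs_of_nonneg h0] at hbig
        refine ⟨(q.1 - n₀, q.2), hq, ?_⟩
        rw [hGhi _ _ hbig, sub_add_cancel]
      · rw [abs_of_neg h0] at hbig
        exact ⟨q, hq, hGlo _ _ (by linarith)⟩
    · push Not at hbig
      -- the base point `φ_{σ₀} q` is a boundary point off the cores, hence a seam point `y`
      set b : Base g := φ (q.1, q.2, σ₀) with hb
      have hbpage : b ∈ page g (d k * Complex.exp ((σ₀ : ℂ) * Complex.I)) := hφp _ _ _ hσ₀I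
      have hunit : ‖d k * Complex.exp ((σ₀ : ℂ) * Complex.I)‖ = 1 := by
        rw [norm_mul, hd, Complex.norm_exp_ofReal_mul_I, mul_one]
      have hbd : b ∈ (𝓡∂ 4).boundary (Base g) := page_subset_boundary g hunit hbpage
      have hoff : ∀ j, b ∉ (h j).core := by
        intro j hbj
        by_cases hjk : j = k
        · subst hjk
          rw [← (h j).range_attachingCircle] at hbj
          obtain ⟨θ, hθ⟩ := hbj
          have h1 : b ∈ page g (d j) := hθ ▸ hcirc θ
          have hne : d j ≠ d j * Complex.exp ((σ₀ : ℂ) * Complex.I) := by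
            intro he
            have : Complex.exp ((σ₀ : ℂ) * Complex.I) = 1 := by
              have hdj : d j ≠ 0 := fun h0 => by have := hd j; rw [h0, norm_zero] at this; exact zero_ne_one this
              exact (mul_right_inj' hdj).1 (by rw [mul_one]; exact he.symm)
            exact exp_ofReal_mul_I_ne_one (σ := σ₀) (by rw [hσ₀]; linarith)
              (by rw [abs_of_pos (by rw [hσ₀]; linarith)]; linarith) this
          exact Set.disjoint_left.1 (disjoint_page g hne) h1 hbpage
        · have h1 : b ∈ range (h j).toFun := image_subset_range _ _ hbj
          have h2 : b ∈ range (h k).toFun := hφt _ _ _ hq hσ₀I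
          exact Set.disjoint_left.1 (D.disjoint hjk) h1 h2
      set a : ↥(coresComplement h) := ⟨b, (mem_coresComplement h).2 hoff⟩ with ha
      obtain ⟨y, hy⟩ := exists_carrier_of_jA bX G₀ D (a := a) hbd
      obtain ⟨c, hc, hcw⟩ := hseam y a hy
      have hdir : ∃ c : ℝ, 0 < c ∧ w g ((bBase g).incl (Ψ y)).1 =
          (c : ℂ) * (d k * Complex.exp ((σ₀ : ℂ) * Complex.I)) :=
        ⟨c / 2, by positivity, by rw [hcw, show w g (a : Base g).1 = _ from hbpage.2]; push_cast; ring⟩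
      rcases hcover y σ₀ ⟨by rw [hσ₀]; linarith, hσ₀lt⟩ hdir with ⟨u, r, hr, hΛy⟩ | ⟨a', hya', hoff'⟩
      · obtain ⟨a'', ha'', hya''⟩ := habove u r σ₀ hr le_rfl hσ₀lt
        have haa : a'' = a := D.injective_jA (by rw [← hya'', hΛy, hy])
        have heq : φ ((G (u, r)).1, (G (u, r)).2, σ₀) = φ (q.1, q.2, σ₀) := by
          rw [← ha'', haa]
        obtain ⟨h2, m, hm⟩ := chart_eq_iff (φ := fun p : ℝ × ℝ => φ (p.1, p.2, σ₀))
          (fun u r => hφ1 u r σ₀) hφσi (p := G (u, r)) (p' := q) (hGstrip u r hr) hq heq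
        refine ⟨(u + m, r), hr, ?_⟩
        rw [hGint, show q = ((G (u, r)).1 + m, (G (u, r)).2) from Prod.ext hm h2.symm]
        exact Prod.ext rfl (add_zero _)
      · exfalso
        have haa : a' = a := D.injective_jA (by rw [← hya', hy])
        apply hoff'
        rw [haa]
        exact ⟨(q.1, q.2), ⟨trivial, abs_le.1 hbig.le⟩, rfl⟩
  exact exists_inverse_stripMap hGc hG1 hGlo hGhi hGstrip hinj hsurj

/-! ## §2 The reflected chart for the downward crossing -/

/-- **The reflected chart.**  With `G'` the inverse lift of the return map, the chart
`Λ' (u, r, σ) = Λ (G' (u, r), −σ)` satisfies the clauses of the slab retraction with sign `ε = −1`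
and return map `G'` (BELOW and ABOVE exchanged and re-coordinatised). [cite: GompfStipsicz1999, §8.2] -/
theorem exists_reflectedChart
    (bX : BoundaryData (𝓡∂ 4) X₀ (𝓡 3)) (Ψ : bX.carrier → (bBase g).carrier)
    (G₀ : X₀ ≃ₘ⟮𝓡∂ 4, 𝓡∂ 4⟯ X) (D : MultiAttachmentData h (𝓡∂ 4) X) {e : ℂ}
    (R : AmbientIsotopy (𝓡∂ 4) (Base g)) (κ : ℝ) (φ : ℝ × ℝ × ℝ → Base g)
    (hrot : ∀ u r σ, φ (u, r, σ) = R.toFun (σ / κ) (φ (u, r, 0))) {η : ℝ}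
    {G G' : ℝ × ℝ → ℝ × ℝ} (hGstrip : ∀ u r, r ∈ Ioo (-1 : ℝ) 1 → (G (u, r)).2 ∈ Ioo (-1 : ℝ) 1)
    (hG'strip : ∀ u r, r ∈ Ioo (-1 : ℝ) 1 → (G' (u, r)).2 ∈ Ioo (-1 : ℝ) 1)
    (hGG' : ∀ p, G (G' p) = p) (hG'G : ∀ p, G' (G p) = p) (hG'c : Continuous G')
    (hG'1 : ∀ u r, G' (u + 1, r) = G' (u, r) + (1, 0))
    (hG'snd : ∀ u r, (1 / 2 : ℝ) ≤ |r| → (G' (u, r)).2 = r)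
    (hG'side : ∀ u r σ, (1 / 2 : ℝ) ≤ |r| → φ ((G' (u, r)).1, (G' (u, r)).2, σ) = φ (u, r, σ))
    {Λ : ℝ × ℝ × ℝ → bX.carrier} (hΛc : ContinuousOn Λ (univ ×ˢ (Ioo (-1 : ℝ) 1 ×ˢ Ioo (-η) η)))
    (hΛi : InjOn Λ (Ico (0 : ℝ) 1 ×ˢ (Ioo (-1 : ℝ) 1 ×ˢ Ioo (-η) η)))
    (hΛ1 : ∀ u r σ, Λ (u + 1, r, σ) = Λ (u, r, σ))
    (hfib : ∀ u r σ, r ∈ Ioo (-1 : ℝ) 1 → σ ∈ Ioo (-η) η → ∃ c : ℝ, 0 < c ∧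
      w g ((bBase g).incl (Ψ (Λ (u, r, σ)))).1 = (c : ℂ) * (e * Complex.exp ((σ : ℂ) * Complex.I)))
    (hbelow : ∀ u r σ, r ∈ Ioo (-1 : ℝ) 1 → σ ∈ Ioo (-η) η → (σ ≤ -(η / 2) ∨ 1 / 2 ≤ |r|) →
      ∃ a : ↥(coresComplement h), (a : Base g) = φ (u, r, σ) ∧ G₀ (bX.incl (Λ (u, r, σ))) = D.jA a)
    (habove : ∀ u r σ, r ∈ Ioo (-1 : ℝ) 1 → η / 2 ≤ σ → σ < η →
      ∃ a : ↥(coresComplement h), (a : Base g) = φ ((G (u, r)).1, (G (u, r)).2, σ) ∧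
        G₀ (bX.incl (Λ (u, r, σ))) = D.jA a)
    (hcover : ∀ (y : bX.carrier) (σ : ℝ), σ ∈ Ioo (-η) η →
      (∃ c : ℝ, 0 < c ∧ w g ((bBase g).incl (Ψ y)).1 = (c : ℂ) * (e * Complex.exp ((σ : ℂ) * Complex.I))) →
      (∃ u r, r ∈ Ioo (-1 : ℝ) 1 ∧ Λ (u, r, σ) = y) ∨
      (∃ a : ↥(coresComplement h), G₀ (bX.incl y) = D.jA a ∧
        (a : Base g) ∉ (fun p : ℝ × ℝ => φ (p.1, p.2, σ)) '' (univ ×ˢ Icc (-(1 / 2) : ℝ) (1 / 2)))) :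
    ∃ Λ' : ℝ × ℝ × ℝ → bX.carrier,
      ContinuousOn Λ' (univ ×ˢ (Ioo (-1 : ℝ) 1 ×ˢ Ioo (-η) η)) ∧
      InjOn Λ' (Ico (0 : ℝ) 1 ×ˢ (Ioo (-1 : ℝ) 1 ×ˢ Ioo (-η) η)) ∧
      (∀ u r σ, Λ' (u + 1, r, σ) = Λ' (u, r, σ)) ∧
      (∀ u r σ, r ∈ Ioo (-1 : ℝ) 1 → σ ∈ Ioo (-η) η → ∃ c : ℝ, 0 < c ∧
        w g ((bBase g).incl (Ψ (Λ' (u, r, σ)))).1 =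
          (c : ℂ) * (e * Complex.exp ((((-1) * σ : ℝ) : ℂ) * Complex.I))) ∧
      (∀ u r σ, r ∈ Ioo (-1 : ℝ) 1 → σ ∈ Ioo (-η) η → (σ ≤ -(η / 2) ∨ 1 / 2 ≤ |r|) →
        ∃ a : ↥(coresComplement h), (a : Base g) = R.toFun ((-1) * σ / κ) (φ (u, r, 0)) ∧
          G₀ (bX.incl (Λ' (u, r, σ))) = D.jA a) ∧
      (∀ u r σ, r ∈ Ioo (-1 : ℝ) 1 → η / 2 ≤ σ → σ < η →
        ∃ a : ↥(coresComplement h), (a : Base g) = R.toFun ((-1) * σ / κ) (φ ((G' (u, r)).1, (G' (u, r)).2, 0)) ∧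
          G₀ (bX.incl (Λ' (u, r, σ))) = D.jA a) ∧
      (∀ (y : bX.carrier) (σ : ℝ), σ ∈ Ioo (-η) η →
        (∃ c : ℝ, 0 < c ∧ w g ((bBase g).incl (Ψ y)).1 =
          (c : ℂ) * (e * Complex.exp ((((-1) * σ : ℝ) : ℂ) * Complex.I))) →
        (∃ u r, r ∈ Ioo (-1 : ℝ) 1 ∧ Λ' (u, r, σ) = y) ∨
        (∃ a : ↥(coresComplement h), G₀ (bX.incl y) = D.jA a ∧
          (a : Base g) ∉ (fun p : ℝ × ℝ => R.toFun ((-1) * σ / κ) (φ (p.1, p.2, 0))) ''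
            (univ ×ˢ Icc (-(1 / 2) : ℝ) (1 / 2)))) := by
  set Λ' : ℝ × ℝ × ℝ → bX.carrier := fun q => Λ ((G' (q.1, q.2.1)).1, (G' (q.1, q.2.1)).2, -q.2.2)
    with hΛ'
  have hG'int : ∀ (m : ℤ) (u r : ℝ), G' (u + m, r) = G' (u, r) + ((m : ℝ), 0) := stripMap_int hG'1
  have hrot' : ∀ u r σ, φ (u, r, -σ) = R.toFun ((-1) * σ / κ) (φ (u, r, 0)) := fun u r σ => by
    rw [hrot, show (-1) * σ / κ = -σ / κ by ring]
  have hexp : ∀ σ : ℝ, Complex.exp ((((-1) * σ : ℝ) : ℂ) * Complex.I) = Complex.exp (((-σ : ℝ) : ℂ) * Complex.I) :=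
    fun σ => by rw [show (-1) * σ = -σ by ring]
  refine ⟨Λ', ?_, ?_, fun u r σ => ?_, fun u r σ hr hσ => ?_, fun u r σ hr hσ hside => ?_,
    fun u r σ hr hlo hhi => ?_, fun y σ hσ hdir => ?_⟩
  · -- continuity on the box
    have hT : Continuous fun q : ℝ × ℝ × ℝ => ((G' (q.1, q.2.1)).1, (G' (q.1, q.2.1)).2, -q.2.2) := by
      have hG'' : Continuous fun q : ℝ × ℝ × ℝ => G' (q.1, q.2.1) :=
        hG'c.comp (continuous_fst.prodMk continuous_snd.fst)
      exact hG''.fst.prodMk (hG''.snd.prodMk continuous_snd.snd.neg)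
    refine hΛc.comp hT.continuousOn fun q hq => ⟨trivial, ?_, ?_⟩
    · exact hG'strip _ _ hq.2.1
    · exact ⟨by linarith [hq.2.2.2], by linarith [hq.2.2.1]⟩
  · -- injectivity on `[0,1) × box`
    rintro ⟨u, r, σ⟩ ⟨hu, hr, hσ⟩ ⟨u', r', σ'⟩ ⟨hu', hr', hσ'⟩ hΛeq
    simp only [hΛ'] at hΛeq
    obtain ⟨h2, m, hm⟩ := box_eq_iff hΛ1 hΛi (p := ((G' (u, r)).1, (G' (u, r)).2, -σ))
      (p' := ((G' (u', r')).1, (G' (u', r')).2, -σ'))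
      ⟨hG'strip _ _ hr, by constructor <;> linarith [hσ.1, hσ.2]⟩
      ⟨hG'strip _ _ hr', by constructor <;> linarith [hσ'.1, hσ'.2]⟩ hΛeq
    simp only [Prod.mk.injEq, neg_inj] at h2 hm
    have hGeq : G' (u', r') = G' (u + m, r) := by
      rw [hG'int]; exact Prod.ext (by simpa using hm) (by simpa using h2.1.symm)
    have hpp : ((u', r') : ℝ × ℝ) = (u + m, r) := by
      have := congrArg G hGeq; rwa [hGG', hGG'] at this
    simp only [Prod.mk.injEq] at hpp
    have hlt : |(m : ℝ)| < 1 := by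
      rw [abs_lt]; constructor <;> linarith [hu.1, hu.2, hu'.1, hu'.2, hpp.1]
    have hm0 : m = 0 := by
      have : |m| < 1 := by exact_mod_cast hlt
      exact Int.abs_lt_one_iff.1 this
    rw [hm0, Int.cast_zero, add_zero] at hpp
    rw [hpp.1, hpp.2, h2.2]
  · -- periodicity
    simp only [hΛ']
    rw [hG'1, Prod.fst_add, Prod.snd_add]
    simp only [add_zero, hΛ1]
  · -- FIBRED
    obtain ⟨c, hc, hcw⟩ := hfib _ _ (-σ) (hG'strip u r hr) ⟨by linarith [hσ.2], by linarith [hσ.1]⟩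
    refine ⟨c, hc, ?_⟩
    simp only [hΛ']
    rw [hcw, hexp]
  · -- BELOW/SIDES for `Λ'`: ABOVE resp. SIDES for `Λ` at the reflected level
    rcases hside with hlo | hbig
    · obtain ⟨a, ha, hya⟩ := habove _ _ (-σ) (hG'strip u r hr) (by linarith) (by linarith [hσ.1])
      refine ⟨a, ?_, by simp only [hΛ']; exact hya⟩
      rw [ha, Prod.mk.eta, hGG', hrot']
    · obtain ⟨a, ha, hya⟩ := hbelow _ _ (-σ) (hG'strip u r hr) ⟨by linarith [hσ.2], by linarith [hσ.1]⟩
        (Or.inr (by rw [hG'snd u r hbig]; exact hbig))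
      refine ⟨a, ?_, by simp only [hΛ']; exact hya⟩
      rw [ha, hG'side u r _ hbig, hrot']
  · -- ABOVE for `Λ'`: BELOW for `Λ`
    obtain ⟨a, ha, hya⟩ := hbelow _ _ (-σ) (hG'strip u r hr) ⟨by linarith, by linarith⟩
      (Or.inl (by linarith))
    refine ⟨a, ?_, by simp only [hΛ']; exact hya⟩
    rw [ha, hrot']
  · -- COVER
    rw [hexp] at hdir
    rcases hcover y (-σ) ⟨by linarith [hσ.2], by linarith [hσ.1]⟩ hdir with ⟨u, r, hr, hΛy⟩ | ⟨a, hya, hoff⟩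
    · refine Or.inl ⟨(G (u, r)).1, (G (u, r)).2, hGstrip u r hr, ?_⟩
      show Λ ((G' ((G (u, r)).1, (G (u, r)).2)).1, (G' ((G (u, r)).1, (G (u, r)).2)).2, -σ) = y
      rw [Prod.mk.eta, hG'G]
      exact hΛy
    · refine Or.inr ⟨a, hya, ?_⟩
      have hset : (fun p : ℝ × ℝ => R.toFun ((-1) * σ / κ) (φ (p.1, p.2, 0))) =
          (fun p : ℝ × ℝ => φ (p.1, p.2, -σ)) := funext fun p => (hrot' p.1 p.2 σ).symm
      rw [hset]
      exact hoff

end CrossCharts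

open CrossCharts

/-! ## The registered form -/

/-- **Sub-goal `helper_reflectedChart_periodic`** (J4, bridge (e×) of the N1 contract, tool 7, fully
qualified; a short clause of `exists_reflectedChart`): re-coordinatising a `1`-periodic box chart by an
equivariant lift and reflecting the levels keeps it `1`-periodic. [cite: GompfStipsicz1999, §8.2] -/
theorem helper_reflectedChart_periodic : ∀ (M : Type) (Λ : ℝ × ℝ × ℝ → M) (G' : ℝ × ℝ → ℝ × ℝ), (∀ u r σ, Λ (u + 1, r, σ) = Λ (u, r, σ)) → (∀ u r, G' (u + 1, r) = G' (u, r) + (1, 0)) → ∀ u r σ, Λ ((G' (u + 1, r)).1, (G' (u + 1, r)).2, -σ) = Λ ((G' (u, r)).1, (G' (u, r)).2, -σ) := by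
  intro M Λ G' hΛ1 hG'1 u r σ
  rw [hG'1, Prod.fst_add, Prod.snd_add]
  simp only [add_zero, hΛ1]

end Summit.SmoothPoincare4.SmoothPoincare4.Theorems.AcyclicBisectionExists.ModpBraidOrbits

end
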